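import Summits.BirchSwinnertonDyer.BirchSwinnertonDyer.Theorems.SignedLowerHalvesSmallImageLowerHalfBothSignsRttCharRoadE2GlueAlgebra
import HarnessLib

/-!
# Route `SignedLowerHalves`, crux L `SmallImageLowerHalfBothSigns` (stmt-BirchSwinnertonDyer-23599), line `rtt_w3` v22 → v23 — stub S3 / S3β (row J4′):
# THE λ-INVARIANT OF A STRUCTURAL (FROBENIUS) DEPLETION `E = C(p^e) · ∏_{w∈T} ([φ_w]^{x_w} − C u_w)` IN CLOSED FORM —
# `λ(Λ_𝒪 ⧸ (E)) = [ℚ_p(S):ℚ_p] · Σ_{w∈T, u_w ≡ 1 (𝔪)} p^{v_p(x_w)}`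

Stub hand `bsd-inputs-lambda-p1` g0 under LEAD `cruxlead-stmt-BirchSwinnertonDyer-23599` g12 (cell `bsd-ssimc`; RULING «S3-DEPLETION» 2026-08-31: for v23 the λ-inequality stub
S3/S3β consumes the depletion in honda g26's STRUCTURAL currency `∏_{w∈T} (ι(binomialSeries ℤ_p x_w) − C u_w)`, `u_w = θ′(φ_w)·χ_cyc(φ_w)`, instead of an Euler identity).
Helper `--supports stmt-BirchSwinnertonDyer-23599`; THEOREMS ONLY (no definition, no named fact, no instance, no `sorry`); pure commutative algebra — nothing about any
cohomology group is asserted; crux L / E2 / S3 / BSD remain OPEN and are proved for NO curve.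

WHAT. For `𝒪 = padicCoeffIntegers S` (`[ℚ_p(S):ℚ_p] < ∞`), `Λ_𝒪 = 𝒪⟦T⟧` with the scalar-tower `Λ = ℤ_p⟦T⟧`-structure of ANY `[Algebra Λ Λ_𝒪]` whose structure map is
`iwasawaToIwasawaO S` (the line file's `letI := (iwasawaToIwasawaO S).toAlgebra`), a finite index set `T`, exponents `x_w ∈ ℤ_p ∖ 0`, constants `u_w ∈ 𝒪` and `e : ℕ`:
* §1 `layerLambda_X_add_C` — `layerLambda (X + C a) = 1` if `‖a‖ < 1` and `= 0` if `‖a‖ = 1` (`‖a‖ ≤ 1`): the one-root count of the linear Euler-type factor.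
* §2 `iwasawaOToPowerSeries_iwasawaToIwasawaO_eq_map`, ★ `iwasawaOToPowerSeries_frobDepletion` — the structural depletion READS in `ℚ̄_p⟦T⟧` as an Euler-type product
  `C(p^e) · 1 · ∏_{w∈T} (X − C u_w)((1+T)^{x_w})` of the shape consumed by the tree's E2-num headline.
* §3 ★★ `lambdaInvariant_quotient_span_frobDepletion_eq` — `λ(Λ_𝒪 ⧸ (E)) = [ℚ_p(S):ℚ_p] · Σ_{w∈T} p^{v_p(x_w)} · [‖1 − u_w‖ < 1]` (the LEAD's
  `lambdaInvariant_quotient_span_eq_of_eulerProduct` with `L := 1`, `d := 0`, `P_w := X − C u_w`, `u := 1`, `f_w := x_w`, and §1), and `frobDepletion_ne_zero`.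
In S3β (v23): with `u_w = N(w)θ(Frob_w)⁻¹` and `p^{v_p(x_w)} = #{primes of K_∞ above w}` this is EXACTLY `λ(Hloc) = Σ_{w unramified, u_w ≡ 1} λ(Λ_𝒪/(P_w))` of BRIEF-E2 rev 6
§1 (L1)/(L3) — so `λ(Λ_𝒪/(E)) ≤ λ(Hloc)` becomes bookkeeping once `𝐇¹_Iw(K_w,T*) ⊇ Λ_𝒪/(P_w)` is in the tree; no `a_ℓ(g) ↔ θ(Frob)` dictionary enters.
References: [Washington1997] §7.1 Thm. 7.3, §13.2; [GreenbergVatsal2000] §2 Prop. (2.4), Cor. (2.3); [PerrinRiou1994Invent] §1.3; [PollackWeston2011MT] §3.1.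
-/

set_option linter.dupNamespace false -- D-0017: single-problem summit, the namespace repeats the problem name by design
set_option autoImplicit false

noncomputable section

open scoped Classical

namespace Summit.BirchSwinnertonDyer.BirchSwinnertonDyer.Theorems.SmallImageRttCharRoad

open PowerSeries Literature.NumberTheory.EllipticCurves Literature.NumberTheory.IwasawaTheory

/-! ## §1. `layerLambda (X + C a)` -/

section LayerLambda

variable {p : ℕ} [Fact p.Prime]

/-- For `‖a‖ ≤ 1` the sup-norm of the coefficients of `X + C a ∈ ℚ̄_p[X]` is `1` (attained at the coefficient of `X`). [cite: PollackWeston2011MT, §3.1] -/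
theorem supNorm_X_add_C {a : PadicAlgCl p} (ha : ‖a‖ ≤ 1) : (Polynomial.X + Polynomial.C a : Polynomial (PadicAlgCl p)).supNorm = 1 := by
  set θ : Polynomial (PadicAlgCl p) := Polynomial.X + Polynomial.C a with hθ
  have h1 : ‖θ.coeff 1‖ = 1 := by
    rw [hθ, Polynomial.coeff_add, Polynomial.coeff_X_one, Polynomial.coeff_C, if_neg one_ne_zero, add_zero, norm_one]
  apply le_antisymm
  · obtain ⟨i, hi⟩ := θ.exists_eq_supNorm
    rw [hi, hθ]
    rcases Nat.lt_trichotomy i 1 with h | h | h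
    · have hi0 : i = 0 := by omega
      subst hi0
      simpa using ha
    · subst h
      simp
    · have h2 : (Polynomial.X + Polynomial.C a : Polynomial (PadicAlgCl p)).coeff i = 0 := by
        rw [Polynomial.coeff_add, Polynomial.coeff_X, Polynomial.coeff_C, if_neg (by omega), if_neg (by omega), add_zero]
      rw [h2, norm_zero]
      exact zero_le_one
  · rw [← h1]; exact θ.le_supNorm 1

/-- ★ **`layerLambda (X + C a) = 1` for `‖a‖ < 1`** (the constant coefficient reduces to `0`, the coefficient of `X` is a unit). [cite: PollackWeston2011MT, §3.1] -/
theorem layerLambda_X_add_C_of_norm_lt_one {a : PadicAlgCl p} (ha : ‖a‖ < 1) :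
    layerLambda (Polynomial.X + Polynomial.C a : Polynomial (PadicAlgCl p)) = 1 := by
  rw [layerLambda_eq_iff, supNorm_X_add_C ha.le]
  refine ⟨by rw [Polynomial.coeff_add, Polynomial.coeff_X_one, Polynomial.coeff_C, if_neg one_ne_zero, add_zero, norm_one], fun j hj ↦ ?_⟩
  have hj0 : j = 0 := by omega
  subst hj0
  rwa [Polynomial.coeff_add, Polynomial.coeff_X_zero, Polynomial.coeff_C_zero, zero_add]

/-- ★ **`layerLambda (X + C a) = 0` for `‖a‖ = 1`** (the constant coefficient is already a unit). [cite: PollackWeston2011MT, §3.1] -/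
theorem layerLambda_X_add_C_of_norm_eq_one {a : PadicAlgCl p} (ha : ‖a‖ = 1) :
    layerLambda (Polynomial.X + Polynomial.C a : Polynomial (PadicAlgCl p)) = 0 := by
  rw [layerLambda_eq_iff, supNorm_X_add_C ha.le]
  exact ⟨by rw [Polynomial.coeff_add, Polynomial.coeff_X_zero, Polynomial.coeff_C_zero, zero_add, ha], fun j hj ↦ absurd hj (Nat.not_lt_zero j)⟩

/-- **`layerLambda (X + C a) = [‖a‖ < 1]`** for `‖a‖ ≤ 1`. [cite: PollackWeston2011MT, §3.1] -/
theorem layerLambda_X_add_C {a : PadicAlgCl p} (ha : ‖a‖ ≤ 1) :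
    layerLambda (Polynomial.X + Polynomial.C a : Polynomial (PadicAlgCl p)) = if ‖a‖ < 1 then 1 else 0 := by
  split_ifs with h
  · exact layerLambda_X_add_C_of_norm_lt_one h
  · exact layerLambda_X_add_C_of_norm_eq_one (le_antisymm ha (not_lt.mp h))

end LayerLambda

/-! ## §2. The structural depletion read in `ℚ̄_p⟦T⟧` -/

section Read

variable {p : ℕ} [Fact p.Prime] (S : Set (PadicAlgCl p))

/-- `𝒪⟦T⟧ → ℚ̄_p⟦T⟧` after `ℤ_p⟦T⟧ → 𝒪⟦T⟧` is the coefficientwise `ℤ_p → ℚ̄_p`. [cite: Washington1997, §7.1 (plumbing)] -/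
theorem iwasawaOToPowerSeries_iwasawaToIwasawaO_eq_map (f : IwasawaAlgebra p) :
    iwasawaOToPowerSeries S (iwasawaToIwasawaO S f) = f.map (algebraMap ℤ_[p] (PadicAlgCl p)) := by
  ext k
  rw [coeff_iwasawaOToPowerSeries, PowerSeries.coeff_map]
  change ((PowerSeries.coeff k (PowerSeries.map (padicIntToCoeffIntegers S) f) : padicCoeffIntegers S) : PadicAlgCl p) = _
  rw [PowerSeries.coeff_map, coe_padicIntToCoeffIntegers, IsScalarTower.algebraMap_apply ℤ_[p] ℚ_[p] (PadicAlgCl p)]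
  rfl

/-- One structural factor reads as the Euler-type factor `(X − C u)((1+T)^x) = aeval (C 1 · (1+T)^x) (X − C u)`. [cite: GreenbergVatsal2000, §2 Prop. (2.4) (shape)] -/
theorem iwasawaOToPowerSeries_binomialSeries_sub_C (x : ℤ_[p]) (u : padicCoeffIntegers S) :
    iwasawaOToPowerSeries S (iwasawaToIwasawaO S (binomialSeries ℤ_[p] x) - PowerSeries.C u) =
      Polynomial.aeval (C (1 : PadicAlgCl p) * (binomialSeries ℤ_[p] x).map (algebraMap ℤ_[p] (PadicAlgCl p)))
        (Polynomial.X - Polynomial.C ((u : padicCoeffIntegers S) : PadicAlgCl p)) := by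
  have hC : iwasawaOToPowerSeries S (PowerSeries.C u) = C ((u : padicCoeffIntegers S) : PadicAlgCl p) := by
    unfold iwasawaOToPowerSeries
    rw [PowerSeries.map_C]
    rfl
  rw [map_sub (iwasawaOToPowerSeries S), iwasawaOToPowerSeries_iwasawaToIwasawaO_eq_map, hC, map_one, one_mul,
    map_sub (Polynomial.aeval _), Polynomial.aeval_X, Polynomial.aeval_C, PowerSeries.algebraMap_apply]
  rfl

/-- ★ **The structural depletion reads as an Euler-type product**: for `E = C(p^e) · ∏_{w∈T} (ι(binomialSeries x_w) − C u_w) ∈ Λ_𝒪`,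
`E^{ℚ̄_p} = C(p^e) · 1 · ∏_{w∈T} aeval (C 1 · (1+T)^{x_w}) (X − C u_w)` — the hypothesis shape of the tree's E2-num headline
(`lambdaInvariant_quotient_span_eq_of_eulerProduct`, with `L := 1`). [cite: GreenbergVatsal2000, §2 Prop. (2.4) (shape)] [cite: Washington1997, §7.1] -/
theorem iwasawaOToPowerSeries_frobDepletion {ι' : Type*} (T : Finset ι') (x : ι' → ℤ_[p]) (u : ι' → padicCoeffIntegers S) (e : ℕ) :
    iwasawaOToPowerSeries S (PowerSeries.C ((p : padicCoeffIntegers S) ^ e) *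
        ∏ w ∈ T, (iwasawaToIwasawaO S (binomialSeries ℤ_[p] (x w)) - PowerSeries.C (u w))) =
      C ((p : PadicAlgCl p) ^ e) * 1 *
        ∏ w ∈ T, Polynomial.aeval (C (1 : PadicAlgCl p) * (binomialSeries ℤ_[p] (x w)).map (algebraMap ℤ_[p] (PadicAlgCl p)))
          (Polynomial.X - Polynomial.C ((u w : padicCoeffIntegers S) : PadicAlgCl p)) := by
  rw [map_mul, map_prod, mul_one]
  congr 1
  · unfold iwasawaOToPowerSeries
    rw [PowerSeries.map_C, map_pow]
    rfl
  · exact Finset.prod_congr rfl fun w _ ↦ iwasawaOToPowerSeries_binomialSeries_sub_C S (x w) (u w)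

end Read

/-! ## §3. ★★ The λ-invariant of `Λ_𝒪 ⧸ (E)` in closed form -/

section Lambda

variable {p : ℕ} [Fact p.Prime] (S : Set (PadicAlgCl p)) [FiniteDimensional ℚ_[p] (padicCoeffField S)]
  [Algebra (IwasawaAlgebra p) (IwasawaAlgebraO S)]

omit [FiniteDimensional ℚ_[p] (padicCoeffField S)] [Algebra (IwasawaAlgebra p) (IwasawaAlgebraO S)] in
/-- Constants of `𝒪 ⊂ ℚ̄_p` have `‖1 − u‖ ≤ 1` (ultrametric inequality, `‖u‖ ≤ 1`). [folklore] -/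
theorem norm_one_sub_coe_le_one (u : padicCoeffIntegers S) : ‖(1 : PadicAlgCl p) - ((u : padicCoeffIntegers S) : PadicAlgCl p)‖ ≤ 1 := by
  have h := PadicAlgCl.isNonarchimedean p (1 : PadicAlgCl p) (-((u : padicCoeffIntegers S) : PadicAlgCl p))
  rw [norm_neg, ← sub_eq_add_neg] at h
  exact h.trans (max_le (by rw [norm_one]) u.2.2)

/-- ★★ **`λ(Λ_𝒪 ⧸ (E)) = [ℚ_p(S):ℚ_p] · Σ_{w∈T} p^{v_p(x_w)} · [‖1 − u_w‖ < 1]`** for the structural depletion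
`E = C(p^e) · ∏_{w∈T} (ι(binomialSeries ℤ_p x_w) − C u_w)` (`x_w ≠ 0`), the `Λ`-structure on `Λ_𝒪 ⧸ (E)` being the scalar tower through any
`[Algebra Λ Λ_𝒪]` with structure map `iwasawaToIwasawaO S` (as in the line-file definition `CharRoadLambda`). Each factor `(1+T)^{x_w} − u_w` contributes
its Weierstrass degree: `p^{v_p(x_w)}` when `u_w ≡ 1 (mod 𝔪_𝒪)`, `0` otherwise; the `p`-power `C(p^e)` contributes nothing. In S3β this is `λ(Hloc)`'s count
(BRIEF-E2 rev 6 §1 (L1)/(L3)) once `u_w = N(w)θ(Frob_w)⁻¹` and `p^{v_p(x_w)} = #{primes of K_∞ above w}`. [cite: Washington1997, §7.1 Thm. 7.3 and §13.2]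
[cite: GreenbergVatsal2000, §2 Prop. (2.4) and Cor. (2.3)] [cite: PerrinRiou1994Invent, §1.3] -/
theorem lambdaInvariant_quotient_span_frobDepletion_eq
    (halg : ∀ r : IwasawaAlgebra p, algebraMap (IwasawaAlgebra p) (IwasawaAlgebraO S) r = iwasawaToIwasawaO S r)
    {ι' : Type*} (T : Finset ι') (x : ι' → ℤ_[p]) (u : ι' → padicCoeffIntegers S) (hx : ∀ w ∈ T, x w ≠ 0) (e : ℕ) :
    lambdaInvariant p (IwasawaAlgebraO S ⧸ Ideal.span {PowerSeries.C ((p : padicCoeffIntegers S) ^ e) *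
        ∏ w ∈ T, (iwasawaToIwasawaO S (binomialSeries ℤ_[p] (x w)) - PowerSeries.C (u w))}) =
      Module.finrank ℚ_[p] (padicCoeffField S) *
        ∑ w ∈ T, p ^ (x w).valuation * (if ‖(1 : PadicAlgCl p) - ((u w : padicCoeffIntegers S) : PadicAlgCl p)‖ < 1 then 1 else 0) := by
  have hc : ((p : PadicAlgCl p) ^ e) ≠ 0 := pow_ne_zero _ (Nat.cast_ne_zero.mpr (Fact.out : p.Prime).ne_zero)
  have hle : ∀ k, ‖coeff k (1 : PowerSeries (PadicAlgCl p))‖ ≤ ‖coeff 0 (1 : PowerSeries (PadicAlgCl p))‖ := fun k ↦ by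
    rw [PowerSeries.coeff_one, PowerSeries.coeff_one, if_pos rfl, norm_one]
    split_ifs
    · rw [norm_one]
    · rw [norm_zero]; exact zero_le_one
  have hlt : ∀ k, k < 0 → ‖coeff k (1 : PowerSeries (PadicAlgCl p))‖ < ‖coeff 0 (1 : PowerSeries (PadicAlgCl p))‖ :=
    fun k hk ↦ absurd hk (Nat.not_lt_zero k)
  have hP : ∀ w ∈ T, (Polynomial.X - Polynomial.C ((u w : padicCoeffIntegers S) : PadicAlgCl p) : Polynomial (PadicAlgCl p)) ≠ 0 :=
    fun w _ ↦ Polynomial.X_sub_C_ne_zero _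
  have h := lambdaInvariant_quotient_span_eq_of_eulerProduct S halg T hc (one_ne_zero) (d := 0) hle hlt
    (fun w ↦ Polynomial.X - Polynomial.C ((u w : padicCoeffIntegers S) : PadicAlgCl p)) (fun _ ↦ (1 : PadicAlgCl p)) x hP
    (fun _ _ ↦ one_ne_zero) hx (iwasawaOToPowerSeries_frobDepletion S T x u e)
  rw [h, zero_add]
  congr 1
  refine Finset.sum_congr rfl fun w _ ↦ ?_
  congr 1
  rw [Polynomial.sub_comp, Polynomial.X_comp, Polynomial.C_comp, map_one, one_mul, add_sub_assoc, ← Polynomial.C_1, ← Polynomial.C_sub,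
    layerLambda_X_add_C (norm_one_sub_coe_le_one S (u w))]

omit [FiniteDimensional ℚ_[p] (padicCoeffField S)] [Algebra (IwasawaAlgebra p) (IwasawaAlgebraO S)] in
/-- The structural depletion is non-zero (`x_w ≠ 0`): its image in `ℚ̄_p⟦T⟧` has a leading index (`ne_zero_of_eulerProduct`). [cite: Washington1997, §7.1] -/
theorem frobDepletion_ne_zero {ι' : Type*} (T : Finset ι') (x : ι' → ℤ_[p]) (u : ι' → padicCoeffIntegers S) (hx : ∀ w ∈ T, x w ≠ 0) (e : ℕ) :
    (PowerSeries.C ((p : padicCoeffIntegers S) ^ e) * ∏ w ∈ T, (iwasawaToIwasawaO S (binomialSeries ℤ_[p] (x w)) - PowerSeries.C (u w)) :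
      IwasawaAlgebraO S) ≠ 0 := by
  have hc : ((p : PadicAlgCl p) ^ e) ≠ 0 := pow_ne_zero _ (Nat.cast_ne_zero.mpr (Fact.out : p.Prime).ne_zero)
  have hle : ∀ k, ‖coeff k (1 : PowerSeries (PadicAlgCl p))‖ ≤ ‖coeff 0 (1 : PowerSeries (PadicAlgCl p))‖ := fun k ↦ by
    rw [PowerSeries.coeff_one, PowerSeries.coeff_one, if_pos rfl, norm_one]
    split_ifs
    · rw [norm_one]
    · rw [norm_zero]; exact zero_le_one
  have hlt : ∀ k, k < 0 → ‖coeff k (1 : PowerSeries (PadicAlgCl p))‖ < ‖coeff 0 (1 : PowerSeries (PadicAlgCl p))‖ :=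
    fun k hk ↦ absurd hk (Nat.not_lt_zero k)
  exact ne_zero_of_eulerProduct S T hc one_ne_zero (d := 0) hle hlt
    (fun w ↦ Polynomial.X - Polynomial.C ((u w : padicCoeffIntegers S) : PadicAlgCl p)) (fun _ ↦ (1 : PadicAlgCl p)) x
    (fun w _ ↦ Polynomial.X_sub_C_ne_zero _) (fun _ _ ↦ one_ne_zero) hx (iwasawaOToPowerSeries_frobDepletion S T x u e)

end Lambda

end Summit.BirchSwinnertonDyer.BirchSwinnertonDyer.Theorems.SmallImageRttCharRoad

end
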